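import Literature.Barriers.QuantumAdvantage.UncorrectedNoiseFourier
import HarnessLib

/-!
# Uncorrected noise, IQP side: output probabilities of `{Z, CZ, T}` IQP circuits and their Fourier coefficients

Support file for the discharge of `bremnerMontanaroShepherd2017_thm4`
(`Literature/Barriers/QuantumAdvantage/UncorrectedNoise.lean`), §3.1 of
Bremner–Montanaro–Shepherd 2017 specialised to the tree's IQP circuits
(`Literature/Computability/Cryptography/SamplingProblems.lean`: `iqpDiag = {Z, CZ, T}`,
`iqpUnitary D = H^{⊗N} U_D H^{⊗N}`, `bornPMF`). Fully proved:

* the diagonal part is diagonal: `mat_eq_diagonal : D.mat = diagonal (circPhase D)` with the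
  phase function `f = circPhase D` (`|f| = 1`; oracle gates are the identity under the empty
  oracle of `QCircuit.mat`);
* amplitudes as character sums (`iqpAmplitude_eq`), the output probabilities `iqpProb D z w`,
  their normalisation `sum_iqpProb` and `bornPMF_iqp_apply` (no renormalisation in `bornPMF`);
* **the Fourier coefficient formula of §3.1**, `cubeFourierCoeff_iqpProb`:
  `p̂_z(S) = 4^{-N} Σ_y \overline{g_z(y)} g_z(y ⊕ 1_S)` with the twisted phase
  `g_z(y) = f(y) χ_{supp z}(y)` accounting for the basis input `|z⟩ = |x 0…0⟩`;
* **exact evaluation for `{Z, CZ, T}`** (`cubeFourierCoeff_iqpProb_eq_prod`): the autocorrelation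
  factorises over the wires, `Σ_y \overline{f(y)} f(y⊕s) = (-1)^{#Z on s + #CZ inside s} ∏_i
  wireFactor(s_i, t_i, λ_i(s))` with `t_i` the `T`-count of wire `i` and `λ_i(s)` the number of
  `CZ` partners of `i` inside `s` — so each coefficient is computed exactly in time `O(N·|D|)`
  (the paper, for general poly-time `f`, estimates the coefficients by Chernoff sampling; for the
  tree's gate set exact evaluation is available and is what the simulating machine will use).

## References

* [BremnerMontanaroShepherd2017] M. J. Bremner, A. Montanaro, D. J. Shepherd, *Achieving quantum
  supremacy with sparse and noisy commuting quantum computations*, Quantum 1 (2017) 8, §1, §3.1.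
* [BremnerJozsaShepherd2011] M. J. Bremner, R. Jozsa, D. J. Shepherd, Proc. R. Soc. A 467 (2011), §2
  (IQP circuits `H D H` with diagonal `D`).
* [NielsenChuang2010] M. A. Nielsen, I. L. Chuang, *Quantum Computation and Quantum Information*,
  CUP 2010, §1.4.4 eq. (1.50) (`H^{⊗n}`), §2.2.5 (Born rule), §4.2 (`T` gate).
* [ODonnell2014] R. O'Donnell, *Analysis of Boolean Functions*, CUP 2014, §1.4.
-/

noncomputable section

namespace Literature.Barriers.QuantumAdvantage

open Finset Matrix
open scoped NNReal ENNReal ComplexConjugate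
open Literature.Probability.RandomGraphs.LowDegree (sgn walsh sgn_true sgn_false)
open Literature.Computability.Complexity.LowDegree (cubeFourierCoeff)
open Literature.Computability.Cryptography

variable {N : ℕ}

/-! ### IQP circuits over `{Z, CZ, T}` are diagonal: the phase function -/

/-- The diagonal entry contributed by one placed gate of the IQP gate set at the basis state `y`
(oracle gates are read with the empty oracle, where they are the identity).
[cite: BremnerJozsaShepherd2011, §2 (IQP: the diagonal part D)] -/
def gatePhase : QGate iqpDiag N → QReg N → ℂ
  | .gate g e, y => iqpDiag.mat g (y ∘ e) (y ∘ e)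
  | .oracle _ _, _ => 1

/-- The phase function `f(y) = ⟨y|D|y⟩` of the diagonal part `D`: the product of the gate
phases. [cite: BremnerMontanaroShepherd2017, Thm 4 ("⟨x|D|x⟩ = f(x)")] -/
def circPhase (D : QCircuit iqpDiag N) (y : QReg N) : ℂ := (D.gates.map fun g => gatePhase g y).prod

/-- The gate matrices of `iqpDiag` are diagonal (off-diagonal entries vanish).
[cite: BremnerJozsaShepherd2011, §2] -/
theorem iqpDiag_mat_of_ne (g : IQPOp) {a b : QReg (iqpDiag.arity g)} (h : a ≠ b) : iqpDiag.mat g a b = 0 := by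
  cases g with
  | Z => show pauliZ a b = 0; simp only [pauliZ, Matrix.of_apply]; rw [if_neg]; exact h
  | CZ => show cz a b = 0; simp only [cz, Matrix.of_apply]; rw [if_neg]; exact h
  | T => show tGate a b = 0; simp only [tGate, Matrix.of_apply]; rw [if_neg]; exact h

/-- The diagonal entries of the `iqpDiag` gates have modulus one. [cite: BremnerJozsaShepherd2011, §2] -/
theorem norm_iqpDiag_mat_self (g : IQPOp) (a : QReg (iqpDiag.arity g)) : ‖iqpDiag.mat g a a‖ = 1 := by
  cases g with
  | Z => show ‖pauliZ a a‖ = 1; simp only [pauliZ, Matrix.of_apply, if_true]; split_ifs <;> simp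
  | CZ => show ‖cz a a‖ = 1; simp only [cz, Matrix.of_apply, if_true]; split_ifs <;> simp
  | T =>
    show ‖tGate a a‖ = 1
    simp only [tGate, Matrix.of_apply, if_true]
    split_ifs
    · rw [Complex.norm_exp]; simp
    · simp

/-- Placing a diagonal gate gives a diagonal operator. (Nielsen–Chuang §4.3.) [folklore] -/
theorem placeGate_eq_diagonal_of_diag {k : ℕ} (e : Fin k ↪ Fin N) (U : Matrix (QReg k) (QReg k) ℂ)
    (hU : ∀ a b, a ≠ b → U a b = 0) :
    placeGate e U = Matrix.diagonal fun y : QReg N => U (y ∘ e) (y ∘ e) := by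
  ext x y
  rw [placeGate_apply, Matrix.diagonal_apply]
  by_cases hxy : x = y
  · subst hxy
    simp
  · rw [if_neg hxy]
    split_ifs with h
    · apply hU
      intro hc
      apply hxy
      funext i
      by_cases hi : i ∈ Set.range e
      · obtain ⟨j, rfl⟩ := hi
        exact congrFun hc j
      · exact h i hi
    · rfl

/-- With the empty oracle an oracle gate is the identity. [folklore] -/
theorem oracleGate_zero (k : ℕ) : oracleGate (0 : Language Bool) k = 1 := by
  ext x y
  simp only [oracleGate, Matrix.of_apply, Matrix.one_apply]
  have h0 : ∀ l : List Bool, (0 : Language Bool).boolIndicator l = false := by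
    intro l; simp [Set.boolIndicator, Language.zero_def]
  simp only [h0, Bool.xor_false]
  by_cases hxy : x = y
  · subst hxy; simp
  · rw [if_neg hxy, if_neg]
    rintro ⟨h1, h2⟩
    apply hxy
    funext i
    refine Fin.lastCases ?_ (fun j => ?_) i
    · exact h2
    · exact h1 j

/-- The matrix of one placed gate of an IQP diagonal part is `diagonal (gatePhase g)`.
[cite: BremnerJozsaShepherd2011, §2] -/
theorem gate_toMatrix_zero (g : QGate iqpDiag N) : g.toMatrix 0 = Matrix.diagonal (gatePhase g) := by
  cases g with
  | gate g e =>
    rw [QGate.toMatrix_gate, placeGate_eq_diagonal_of_diag e _ (fun _ _ h => iqpDiag_mat_of_ne g h)]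
    rfl
  | oracle k e =>
    rw [QGate.toMatrix_oracle, oracleGate_zero, placeGate_one]
    ext x y
    simp [gatePhase, Matrix.one_apply, Matrix.diagonal_apply]

/-- **IQP diagonal parts are diagonal**: `U_D = diag(f)` with `f = circPhase D`.
[cite: BremnerMontanaroShepherd2017, Thm 4 ("whose diagonal part D is defined by ⟨x|D|x⟩ = f(x)")] -/
theorem mat_eq_diagonal (D : QCircuit iqpDiag N) : D.mat = Matrix.diagonal (circPhase D) := by
  obtain ⟨gs⟩ := D
  induction gs with
  | nil =>
    rw [QCircuit.mat, QCircuit.toMatrix_nil]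
    ext x y
    simp [circPhase, Matrix.one_apply, Matrix.diagonal_apply]
  | cons g gs ih =>
    rw [QCircuit.mat, QCircuit.toMatrix_cons] at *
    rw [ih, gate_toMatrix_zero, Matrix.diagonal_mul_diagonal]
    congr 1
    funext y
    simp only [circPhase, List.map_cons, List.prod_cons]
    ring

/-- The phases have modulus one. [cite: BremnerJozsaShepherd2011, §2] -/
theorem norm_gatePhase (g : QGate iqpDiag N) (y : QReg N) : ‖gatePhase g y‖ = 1 := by
  cases g with
  | gate g e => exact norm_iqpDiag_mat_self g _
  | oracle k e => simp [gatePhase]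

/-- `|f(y)| = 1`. [cite: BremnerJozsaShepherd2011, §2] -/
theorem norm_circPhase (D : QCircuit iqpDiag N) (y : QReg N) : ‖circPhase D y‖ = 1 := by
  obtain ⟨gs⟩ := D
  unfold circPhase
  induction gs with
  | nil => simp
  | cons g gs ih => rw [List.map_cons, List.prod_cons, norm_mul, norm_gatePhase, one_mul]; exact ih

/-! ### The Hadamard sandwich: amplitudes as character sums -/

/-- The support of a bit string as a finite set of positions. [folklore] -/
def supp (x : QReg N) : Finset (Fin N) := univ.filter fun i => x i = true

/-- The sign of the Hadamard transform is a Walsh character: `(-1)^{x·y} = χ_{supp x}(y)`.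
[cite: NielsenChuang2010, §1.4.4 eq. (1.50)] -/
theorem negOnePow_card_eq_walsh (x y : QReg N) :
    (-1 : ℂ) ^ (univ.filter fun i => x i = true ∧ y i = true).card = ((walsh (supp x) y : ℝ) : ℂ) := by
  rw [Literature.Computability.Cryptography.neg_one_pow_card_filter_and, walsh, supp, Finset.prod_filter,
    Complex.ofReal_prod]
  refine Finset.prod_congr rfl fun i _ => ?_
  cases x i <;> cases y i <;> simp [sgn]

/-- `χ_{supp x}(y) = χ_{supp y}(x)` (the dot product is symmetric). [folklore] -/
theorem walsh_supp_comm (x y : QReg N) : walsh (supp x) y = walsh (supp y) x := by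
  rw [walsh, walsh, supp, supp, Finset.prod_filter, Finset.prod_filter]
  refine Finset.prod_congr rfl fun i _ => ?_
  cases x i <;> cases y i <;> simp [sgn]

/-- Entries of `H^{⊗N}` through Walsh characters. [cite: NielsenChuang2010, §1.4.4 eq. (1.50)] -/
theorem hGateAll_apply_eq (x y : QReg N) :
    hGateAll N x y = ((Real.sqrt 2 : ℂ)⁻¹) ^ N * ((walsh (supp x) y : ℝ) : ℂ) := by
  rw [hGateAll, Matrix.of_apply, negOnePow_card_eq_walsh]

/-- The twisted phase `g_z(y) = f(y) χ_{supp z}(y)` of the circuit run on the basis input `|z⟩`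
(`H^{⊗N}|z⟩ = 2^{-N/2} Σ_y χ_{supp z}(y) |y⟩`). [cite: BremnerMontanaroShepherd2017, §1 ("⟨x|𝒞|y⟩ = ⟨x+y|𝒞|0⟩": the input only twists the phases)] -/
def twistedPhase (D : QCircuit iqpDiag N) (z y : QReg N) : ℂ := circPhase D y * ((walsh (supp z) y : ℝ) : ℂ)

/-- `|g_z(y)| = 1`. [folklore] -/
theorem norm_twistedPhase (D : QCircuit iqpDiag N) (z y : QReg N) : ‖twistedPhase D z y‖ = 1 := by
  rw [twistedPhase, norm_mul, norm_circPhase, one_mul, Complex.norm_real, Real.norm_eq_abs, walsh,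
    Finset.abs_prod]
  refine Finset.prod_eq_one fun i _ => ?_
  cases y i <;> simp [sgn]

/-- The output amplitude `⟨w| H^{⊗N} U_D H^{⊗N} |z⟩`. [cite: BremnerMontanaroShepherd2017, Thm 4 (the circuit 𝒞 = H^{⊗n} D H^{⊗n})] -/
def iqpAmplitude (D : QCircuit iqpDiag N) (z w : QReg N) : ℂ := (iqpUnitary D *ᵥ basisState z) w

/-- `(1/√2)^N (1/√2)^N = 2^{-N}` in `ℂ`. [folklore] -/
theorem sqrt_two_inv_pow_mul_self (N : ℕ) :
    ((Real.sqrt 2 : ℂ)⁻¹) ^ N * ((Real.sqrt 2 : ℂ)⁻¹) ^ N = ((2 : ℂ) ^ N)⁻¹ := by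
  have h := Literature.Computability.Cryptography.sqrt_two_inv_pow_mul_pow_mul_two_pow N
  have h2 : (2 : ℂ) ^ N ≠ 0 := pow_ne_zero _ two_ne_zero
  calc ((Real.sqrt 2 : ℂ)⁻¹) ^ N * ((Real.sqrt 2 : ℂ)⁻¹) ^ N
      = ((Real.sqrt 2 : ℂ)⁻¹) ^ N * ((Real.sqrt 2 : ℂ)⁻¹) ^ N * 2 ^ N * ((2 : ℂ) ^ N)⁻¹ := by
        rw [mul_assoc, mul_inv_cancel₀ h2, mul_one]
    _ = ((2 : ℂ) ^ N)⁻¹ := by rw [h, one_mul]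

/-- **Amplitudes of an IQP circuit are character sums of the phase function**:
`⟨w|H D H|z⟩ = 2^{-N} Σ_y χ_{supp w}(y) f(y) χ_{supp z}(y)`.
[cite: BremnerMontanaroShepherd2017, §3.1 (second display: the amplitude 2^{-n} Σ_y f(y)(-1)^{x·y})] -/
theorem iqpAmplitude_eq (D : QCircuit iqpDiag N) (z w : QReg N) :
    iqpAmplitude D z w = ((2 : ℂ) ^ N)⁻¹ * ∑ y, ((walsh (supp w) y : ℝ) : ℂ) * twistedPhase D z y := by
  unfold iqpAmplitude
  rw [basisState, Matrix.mulVec_single_one, Matrix.col_apply, iqpUnitary, mat_eq_diagonal,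
    Matrix.mul_apply]
  simp_rw [Matrix.mul_diagonal, hGateAll_apply_eq]
  rw [← sqrt_two_inv_pow_mul_self, Finset.mul_sum]
  refine Finset.sum_congr rfl fun y _ => ?_
  rw [twistedPhase, walsh_supp_comm y z]
  ring

/-- The ideal output probabilities `p_z(w) = |⟨w|H D H|z⟩|²`. [cite: BremnerMontanaroShepherd2017, Thm 4 ("the probability of receiving output x")] -/
def iqpProb (D : QCircuit iqpDiag N) (z w : QReg N) : ℝ := ‖iqpAmplitude D z w‖ ^ 2

/-- The output probabilities are nonnegative. [folklore] -/
theorem iqpProb_nonneg (D : QCircuit iqpDiag N) (z w : QReg N) : 0 ≤ iqpProb D z w := sq_nonneg _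

/-- Triple character sums: `Σ_w χ_{supp y}(w) χ_{supp y'}(w) χ_S(w) = 2^N [supp y ∆ supp y' = S]`,
through `χ_A χ_B = χ_{A ∆ B}` and orthogonality. [cite: ODonnell2014, §1.4] -/
theorem walsh_mul_walsh_eq_symmDiff (A B : Finset (Fin N)) (w : QReg N) :
    walsh A w * walsh B w = walsh (symmDiff A B) w := by
  classical
  rw [Literature.Computability.Complexity.LowDegree.walsh_eq_prod_ite,
    Literature.Computability.Complexity.LowDegree.walsh_eq_prod_ite,
    Literature.Computability.Complexity.LowDegree.walsh_eq_prod_ite, ← Finset.prod_mul_distrib]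
  refine Finset.prod_congr rfl fun i _ => ?_
  by_cases hA : i ∈ A <;> by_cases hB : i ∈ B <;> simp [hA, hB, Finset.mem_symmDiff]

/-- `supp (y ⊕ e) = supp y ∆ supp e`. [folklore] -/
theorem supp_bxor (y e : QReg N) : supp (bxor y e) = symmDiff (supp y) (supp e) := by
  ext i
  simp only [supp, Finset.mem_filter, Finset.mem_univ, true_and, Finset.mem_symmDiff, bxor]
  cases y i <;> cases e i <;> simp

/-- The indicator string of a set of positions. [folklore] -/
def indic (S : Finset (Fin N)) : QReg N := fun i => decide (i ∈ S)

/-- `supp (indic S) = S`. [folklore] -/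
@[simp] theorem supp_indic (S : Finset (Fin N)) : supp (indic S) = S := by
  ext i; simp [supp, indic]

/-- `supp` is injective. [folklore] -/
theorem supp_injective : Function.Injective (supp : QReg N → Finset (Fin N)) := by
  intro x y h
  funext i
  have := congrArg (fun S : Finset (Fin N) => decide (i ∈ S)) h
  simp only [supp, Finset.mem_filter, Finset.mem_univ, true_and] at this
  cases hx : x i <;> cases hy : y i <;> simp_all

/-- `supp y ∆ supp y' = S ↔ y = y' ⊕ 1_S`. [folklore] -/
theorem symmDiff_supp_eq_iff (y y' : QReg N) (S : Finset (Fin N)) :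
    symmDiff (supp y) (supp y') = S ↔ y = bxor y' (indic S) := by
  constructor
  · intro h
    apply supp_injective
    rw [supp_bxor, supp_indic, ← h, ← symmDiff_assoc, symmDiff_comm (supp y') (supp y), symmDiff_assoc,
      symmDiff_self, symmDiff_bot]
  · rintro rfl
    rw [supp_bxor, supp_indic, symmDiff_comm, ← symmDiff_assoc, symmDiff_self, bot_symmDiff]

/-- The squared modulus of an amplitude as a double character sum. [folklore] -/
theorem iqpProb_eq_sum (D : QCircuit iqpDiag N) (z w : QReg N) :
    ((iqpProb D z w : ℝ) : ℂ) = ((2 : ℂ) ^ N)⁻¹ * ((2 : ℂ) ^ N)⁻¹ *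
      ∑ y, ∑ y', ((walsh (symmDiff (supp y) (supp y')) w : ℝ) : ℂ) *
        (twistedPhase D z y * conj (twistedPhase D z y')) := by
  rw [iqpProb, ← Complex.normSq_eq_norm_sq, ← Complex.mul_conj, iqpAmplitude_eq]
  rw [map_mul, map_inv₀, map_pow, Complex.conj_ofNat, map_sum,
    show ∀ (c A B : ℂ), c * A * (c * B) = c * c * (A * B) from fun c A B => by ring, Finset.sum_mul_sum]
  congr 1
  refine Finset.sum_congr rfl fun y _ => Finset.sum_congr rfl fun y' _ => ?_
  rw [map_mul, Complex.conj_ofReal, ← walsh_mul_walsh_eq_symmDiff, walsh_supp_comm y w, walsh_supp_comm y' w]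
  push_cast
  ring

/-- **Normalisation**: `Σ_w |⟨w|H D H|z⟩|² = 1` (Parseval for the unimodular `g_z`; equivalently
unitarity of the IQP circuit). [cite: BremnerJozsaShepherd2011, §2] -/
theorem sum_iqpProb (D : QCircuit iqpDiag N) (z : QReg N) : ∑ w, iqpProb D z w = 1 := by
  have h2 : (2 : ℂ) ^ N ≠ 0 := pow_ne_zero _ two_ne_zero
  have key : ((∑ w, iqpProb D z w : ℝ) : ℂ) = 1 := by
    rw [Complex.ofReal_sum]
    simp_rw [iqpProb_eq_sum]
    rw [← Finset.mul_sum, Finset.sum_comm]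
    have inner : ∀ y : QReg N, ∑ w, ∑ y', ((walsh (symmDiff (supp y) (supp y')) w : ℝ) : ℂ) *
        (twistedPhase D z y * conj (twistedPhase D z y')) = (2 : ℂ) ^ N := by
      intro y
      rw [Finset.sum_comm]
      have hy' : ∀ y' : QReg N, ∑ w, ((walsh (symmDiff (supp y) (supp y')) w : ℝ) : ℂ) *
          (twistedPhase D z y * conj (twistedPhase D z y')) =
            if y' = y then (2 : ℂ) ^ N else 0 := by
        intro y'
        rw [← Finset.sum_mul, ← Complex.ofReal_sum]
        have hs : ∑ w, walsh (symmDiff (supp y) (supp y')) w =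
            if symmDiff (supp y) (supp y') = ∅ then (2 : ℝ) ^ N else 0 := by
          have := Literature.Computability.Complexity.LowDegree.sum_walsh_mul_walsh_index
            (symmDiff (supp y) (supp y')) (∅ : Finset (Fin N))
          simpa using this
        rw [hs]
        by_cases hyy : y = y'
        · subst hyy
          rw [if_pos (by rw [Finset.symmDiff_eq_empty]), if_pos rfl, Complex.mul_conj,
            Complex.normSq_eq_norm_sq, norm_twistedPhase]
          push_cast; ring
        · rw [if_neg (by rwa [Finset.symmDiff_eq_empty, supp_injective.eq_iff]), if_neg (Ne.symm hyy)]
          push_cast; ring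
      simp_rw [hy']
      rw [Finset.sum_ite_eq' univ y, if_pos (Finset.mem_univ _)]
    simp_rw [inner]
    rw [Finset.sum_const, Finset.card_univ, Fintype.card_fun, Fintype.card_bool, Fintype.card_fin,
      nsmul_eq_mul]
    push_cast
    field_simp
  exact_mod_cast key

/-- The Born distribution of an IQP circuit on a basis input assigns the squared amplitudes (no
renormalisation). [cite: NielsenChuang2010, §2.2.5] -/
theorem bornPMF_iqp_apply (D : QCircuit iqpDiag N) (z w : QReg N) :
    bornPMF (iqpUnitary D *ᵥ basisState z) w = ENNReal.ofReal (iqpProb D z w) :=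
  Literature.Computability.Cryptography.bornPMF_apply_of_sum_eq_one (sum_iqpProb D z) w

/-- Real masses of the Born distribution of an IQP circuit. [cite: NielsenChuang2010, §2.2.5] -/
theorem toReal_bornPMF_iqp_apply (D : QCircuit iqpDiag N) (z w : QReg N) :
    (bornPMF (iqpUnitary D *ᵥ basisState z) w).toReal = iqpProb D z w := by
  rw [bornPMF_iqp_apply, ENNReal.toReal_ofReal (iqpProb_nonneg D z w)]

/-- **Fourier coefficients of the IQP output distribution** (§3.1, third display):
`p̂_z(S) = 2^{-2N} Σ_y \overline{g_z(y)} g_z(y ⊕ 1_S)` — an autocorrelation of the twisted phase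
function. [cite: BremnerMontanaroShepherd2017, §3.1 (display "p̂(s) = 2^{-2n} Σ_y \overline{f(y)} f(y+s)")] -/
theorem cubeFourierCoeff_iqpProb (D : QCircuit iqpDiag N) (z : QReg N) (S : Finset (Fin N)) :
    ((cubeFourierCoeff (iqpProb D z) S : ℝ) : ℂ) =
      ((2 : ℂ) ^ N)⁻¹ * ((2 : ℂ) ^ N)⁻¹ * ∑ y', conj (twistedPhase D z y') * twistedPhase D z (bxor y' (indic S)) := by
  have h2 : (2 : ℂ) ^ N ≠ 0 := pow_ne_zero _ two_ne_zero
  unfold cubeFourierCoeff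
  rw [Complex.ofReal_div, Complex.ofReal_sum, Complex.ofReal_pow, Complex.ofReal_ofNat]
  simp_rw [Complex.ofReal_mul, iqpProb_eq_sum]
  -- move the character `χ_S(w)` inside and sum over `w` first
  have step : ∀ w : QReg N, ((2 : ℂ) ^ N)⁻¹ * ((2 : ℂ) ^ N)⁻¹ *
      (∑ y, ∑ y', ((walsh (symmDiff (supp y) (supp y')) w : ℝ) : ℂ) *
        (twistedPhase D z y * conj (twistedPhase D z y'))) * ((walsh S w : ℝ) : ℂ) =
      ((2 : ℂ) ^ N)⁻¹ * ((2 : ℂ) ^ N)⁻¹ *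
      ∑ y, ∑ y', ((walsh (symmDiff (supp y) (supp y')) w * walsh S w : ℝ) : ℂ) *
        (twistedPhase D z y * conj (twistedPhase D z y')) := by
    intro w
    rw [mul_assoc, Finset.sum_mul]
    congr 1
    refine Finset.sum_congr rfl fun y _ => ?_
    rw [Finset.sum_mul]
    refine Finset.sum_congr rfl fun y' _ => ?_
    push_cast; ring
  simp_rw [step]
  rw [← Finset.mul_sum, Finset.sum_comm]
  simp_rw [Finset.sum_comm (s := (univ : Finset (QReg N))) (t := (univ : Finset (QReg N)))
    (f := fun w y' => ((walsh (symmDiff (supp _) (supp y')) w * walsh S w : ℝ) : ℂ) * _)]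
  have hw : ∀ y y' : QReg N, ∑ w, ((walsh (symmDiff (supp y) (supp y')) w * walsh S w : ℝ) : ℂ) *
      (twistedPhase D z y * conj (twistedPhase D z y')) =
      if y = bxor y' (indic S) then (2 : ℂ) ^ N * (twistedPhase D z y * conj (twistedPhase D z y')) else 0 := by
    intro y y'
    rw [← Finset.sum_mul, ← Complex.ofReal_sum,
      Literature.Computability.Complexity.LowDegree.sum_walsh_mul_walsh_index]
    by_cases h : y = bxor y' (indic S)
    · rw [if_pos ((symmDiff_supp_eq_iff y y' S).mpr h), if_pos h]; push_cast; ring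
    · rw [if_neg (fun h' => h ((symmDiff_supp_eq_iff y y' S).mp h')), if_neg h]; push_cast; ring
  simp_rw [hw]
  rw [Finset.sum_comm]
  simp_rw [Finset.sum_ite_eq' univ, if_pos (Finset.mem_univ _)]
  rw [← Finset.mul_sum]
  field_simp
  refine Finset.sum_congr rfl fun y' _ => ?_
  ring

end Literature.Barriers.QuantumAdvantage

namespace Literature.Barriers.QuantumAdvantage

open Finset Matrix
open scoped NNReal ENNReal ComplexConjugate
open Literature.Probability.RandomGraphs.LowDegree (sgn walsh sgn_true sgn_false)
open Literature.Computability.Complexity.LowDegree (cubeFourierCoeff)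
open Literature.Computability.Cryptography

variable {N : ℕ}

/-! ### The autocorrelation of the phase function factorises over the wires

For the gate set `{Z, CZ, T}` the summand `\overline{f(y)} f(y ⊕ s)` of the Fourier coefficient
is, gate by gate, a product of one-wire functions of `y`; hence the sum over `y` is a product over
the wires of two-term sums, computable exactly in time `O(N · |D|)` from four integer statistics
of the gate list (this replaces the Chernoff sampling of the paper, which only needs approximate
coefficients, by an exact evaluation available for this gate set). -/

/-- `ω = e^{iπ/4}`, the `T`-gate phase. [cite: NielsenChuang2010, §4.2 (T = diag(1, e^{iπ/4}))] -/
def omega8 : ℂ := Complex.exp (Real.pi / 4 * Complex.I)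

/-- The sign `(-1)^b` as a complex number. [folklore] -/
def sgnC (b : Bool) : ℂ := if b = true then -1 else 1

/-- `sgnC` is the real sign `sgn` cast to `ℂ`. [folklore] -/
theorem sgnC_eq_coe (b : Bool) : sgnC b = ((sgn b : ℝ) : ℂ) := by cases b <;> simp [sgnC, sgn]

/-- The one-wire factor of a `T` gate in `\overline{f(y)} f(y ⊕ s)`: `1` if the wire is not
shifted, else `ω` or `ω̄` according to the bit. [folklore] -/
def psiT (si b : Bool) : ℂ := if si = true then (if b = true then conj omega8 else omega8) else 1

/-- `0 < arity` witnesses for the wire indices of the IQP gates. [folklore] -/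
theorem iqpDiag_arity_pos (g : IQPOp) : 0 < iqpDiag.arity g := by cases g <;> decide

/-- `1 < arity CZ`. [folklore] -/
theorem iqpDiag_arity_CZ : 1 < iqpDiag.arity IQPOp.CZ := by decide

/-- The first wire of a placed gate. [folklore] -/
def wire0 (g : IQPOp) (e : Fin (iqpDiag.arity g) ↪ Fin N) : Fin N := e ⟨0, iqpDiag_arity_pos g⟩

/-- The second wire of a placed `CZ`. [folklore] -/
def wire1 (e : Fin (iqpDiag.arity IQPOp.CZ) ↪ Fin N) : Fin N := e ⟨1, iqpDiag_arity_CZ⟩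

/-- The two wires of a placed `CZ` differ. [folklore] -/
theorem wire0_ne_wire1 (e : Fin (iqpDiag.arity IQPOp.CZ) ↪ Fin N) : wire0 IQPOp.CZ e ≠ wire1 e := by
  intro h
  have := e.injective h
  simp at this

/-- Number of `T` gates on wire `i`. [folklore] -/
def tCountW : List (QGate iqpDiag N) → Fin N → ℕ
  | [], _ => 0
  | QGate.gate IQPOp.T e :: L, i => tCountW L i + if wire0 IQPOp.T e = i then 1 else 0
  | QGate.gate IQPOp.Z _ :: L, i => tCountW L i
  | QGate.gate IQPOp.CZ _ :: L, i => tCountW L i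
  | QGate.oracle _ _ :: L, i => tCountW L i

/-- Number of `Z` gates sitting on a shifted wire (`s_i = 1`). [folklore] -/
def zOnShift : List (QGate iqpDiag N) → QReg N → ℕ
  | [], _ => 0
  | QGate.gate IQPOp.Z e :: L, s => zOnShift L s + if s (wire0 IQPOp.Z e) = true then 1 else 0
  | QGate.gate IQPOp.T _ :: L, s => zOnShift L s
  | QGate.gate IQPOp.CZ _ :: L, s => zOnShift L s
  | QGate.oracle _ _ :: L, s => zOnShift L s

/-- Number of `CZ` gates with both wires shifted. [folklore] -/
def czInShift : List (QGate iqpDiag N) → QReg N → ℕ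
  | [], _ => 0
  | QGate.gate IQPOp.CZ e :: L, s => czInShift L s +
      if s (wire0 IQPOp.CZ e) = true ∧ s (wire1 e) = true then 1 else 0
  | QGate.gate IQPOp.Z _ :: L, s => czInShift L s
  | QGate.gate IQPOp.T _ :: L, s => czInShift L s
  | QGate.oracle _ _ :: L, s => czInShift L s

/-- Number of `CZ` gates at wire `i` whose *other* wire is shifted. [folklore] -/
def czDeg : List (QGate iqpDiag N) → QReg N → Fin N → ℕ
  | [], _, _ => 0
  | QGate.gate IQPOp.CZ e :: L, s, i => czDeg L s i +
      (if wire0 IQPOp.CZ e = i ∧ s (wire1 e) = true then 1 else 0) +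
      (if wire1 e = i ∧ s (wire0 IQPOp.CZ e) = true then 1 else 0)
  | QGate.gate IQPOp.Z _ :: L, s, i => czDeg L s i
  | QGate.gate IQPOp.T _ :: L, s, i => czDeg L s i
  | QGate.oracle _ _ :: L, s, i => czDeg L s i

/-- The autocorrelation summand of a gate list: `\overline{f(y)} f(y ⊕ s)`. [cite: BremnerMontanaroShepherd2017, §3.1] -/
def corr (L : List (QGate iqpDiag N)) (s y : QReg N) : ℂ :=
  conj (circPhase ⟨L⟩ y) * circPhase ⟨L⟩ (bxor y s)

/-- The factorised form. [folklore] -/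
def corrRHS (L : List (QGate iqpDiag N)) (s y : QReg N) : ℂ :=
  (-1) ^ (zOnShift L s + czInShift L s) * ∏ i, psiT (s i) (y i) ^ tCountW L i * sgnC (y i) ^ czDeg L s i

/-- Phase of a placed `Z`: the sign of its wire. [folklore] -/
theorem gatePhase_Z (e : Fin (iqpDiag.arity IQPOp.Z) ↪ Fin N) (y : QReg N) :
    gatePhase (QGate.gate IQPOp.Z e) y = sgnC (y (wire0 IQPOp.Z e)) := by
  show pauliZ (y ∘ e) (y ∘ e) = _
  simp only [pauliZ, Matrix.of_apply, if_true, sgnC, Function.comp_apply]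
  rfl

/-- Phase of a placed `T`: `ω` if its wire is set. [folklore] -/
theorem gatePhase_T (e : Fin (iqpDiag.arity IQPOp.T) ↪ Fin N) (y : QReg N) :
    gatePhase (QGate.gate IQPOp.T e) y = if y (wire0 IQPOp.T e) = true then omega8 else 1 := by
  show tGate (y ∘ e) (y ∘ e) = _
  simp only [tGate, Matrix.of_apply, if_true, omega8, Function.comp_apply]
  rfl

/-- Phase of a placed `CZ`: `-1` iff both its wires are set. [folklore] -/
theorem gatePhase_CZ (e : Fin (iqpDiag.arity IQPOp.CZ) ↪ Fin N) (y : QReg N) :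
    gatePhase (QGate.gate IQPOp.CZ e) y =
      if y (wire0 IQPOp.CZ e) = true ∧ y (wire1 e) = true then -1 else 1 := by
  show cz (y ∘ e) (y ∘ e) = _
  simp only [cz, Matrix.of_apply, if_true, Function.comp_apply]
  rfl

/-- Bumping one exponent in a product over the wires pulls out one factor. [folklore] -/
theorem prod_pow_add_indicator (F : Fin N → ℂ) (t : Fin N → ℕ) (i₀ : Fin N) :
    ∏ i, F i ^ (t i + if i₀ = i then 1 else 0) = F i₀ * ∏ i, F i ^ t i := by
  simp_rw [pow_add, Finset.prod_mul_distrib, pow_ite, pow_one, pow_zero]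
  rw [Finset.prod_ite_eq univ i₀, if_pos (Finset.mem_univ _), mul_comm]

/-- **Gate-by-gate factorisation** of `\overline{f(y)} f(y ⊕ s)` over the wires for the gate set
`{Z, CZ, T}`: `= (-1)^{#Z on s + #CZ inside s} ∏_i ψ_{s_i}(y_i)^{t_i} (-1)^{y_i λ_i(s)}`.
[folklore] -/
theorem corr_eq_corrRHS : ∀ (L : List (QGate iqpDiag N)) (s y : QReg N), corr L s y = corrRHS L s y
  | [], s, y => by simp [corr, corrRHS, circPhase, tCountW, czDeg, zOnShift, czInShift]
  | QGate.oracle k e :: L, s, y => by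
    have ih := corr_eq_corrRHS L s y
    simp only [corr, corrRHS, circPhase, List.map_cons, List.prod_cons, gatePhase, one_mul,
      tCountW, czDeg, zOnShift, czInShift] at ih ⊢
    exact ih
  | QGate.gate IQPOp.Z e :: L, s, y => by
    have ih := corr_eq_corrRHS L s y
    simp only [corr, corrRHS, circPhase, List.map_cons, List.prod_cons, map_mul, tCountW, czDeg, zOnShift,
      czInShift] at ih ⊢
    rw [gatePhase_Z, gatePhase_Z, show ∀ a b c d : ℂ, a * b * (c * d) = (a * c) * (b * d) from fun _ _ _ _ => by ring]
    rw [ih]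
    simp only [bxor]
    cases s (wire0 IQPOp.Z e) <;> cases y (wire0 IQPOp.Z e) <;> simp [sgnC] <;> ring
  | QGate.gate IQPOp.T e :: L, s, y => by
    have ih := corr_eq_corrRHS L s y
    simp only [corr, corrRHS, circPhase, List.map_cons, List.prod_cons, map_mul, tCountW, czDeg, zOnShift,
      czInShift] at ih ⊢
    rw [gatePhase_T, gatePhase_T, show ∀ a b c d : ℂ, a * b * (c * d) = (a * c) * (b * d) from fun _ _ _ _ => by ring]
    rw [ih]
    have hprod : ∏ i, psiT (s i) (y i) ^ (tCountW L i + if wire0 IQPOp.T e = i then 1 else 0) * sgnC (y i) ^ czDeg L s i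
        = psiT (s (wire0 IQPOp.T e)) (y (wire0 IQPOp.T e)) * ∏ i, psiT (s i) (y i) ^ tCountW L i * sgnC (y i) ^ czDeg L s i := by
      rw [Finset.prod_mul_distrib, Finset.prod_mul_distrib, prod_pow_add_indicator (fun i => psiT (s i) (y i))]
      ring
    rw [hprod]
    have hω : (starRingEnd ℂ) omega8 * omega8 = 1 := by
      rw [mul_comm, Complex.mul_conj, Complex.normSq_eq_norm_sq, omega8, Complex.norm_exp]
      simp
    simp only [bxor]
    clear hprod ih
    rcases Bool.eq_false_or_eq_true (s (wire0 IQPOp.T e)) with hs | hs <;>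
      rcases Bool.eq_false_or_eq_true (y (wire0 IQPOp.T e)) with hy | hy <;> simp [hs, hy, psiT, hω] <;> ring
  | QGate.gate IQPOp.CZ e :: L, s, y => by
    have ih := corr_eq_corrRHS L s y
    simp only [corr, corrRHS, circPhase, List.map_cons, List.prod_cons, map_mul, tCountW, czDeg, zOnShift,
      czInShift] at ih ⊢
    rw [gatePhase_CZ, gatePhase_CZ, show ∀ a b c d : ℂ, a * b * (c * d) = (a * c) * (b * d) from fun _ _ _ _ => by ring]
    rw [ih]
    have hne := wire0_ne_wire1 e
    -- split the exponent bumps of the two (distinct) wires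
    have hprod : ∏ i, psiT (s i) (y i) ^ tCountW L i * sgnC (y i) ^
        (czDeg L s i + (if wire0 IQPOp.CZ e = i ∧ s (wire1 e) = true then 1 else 0) +
          (if wire1 e = i ∧ s (wire0 IQPOp.CZ e) = true then 1 else 0))
        = (sgnC (y (wire0 IQPOp.CZ e)) ^ (if s (wire1 e) = true then 1 else 0) *
            sgnC (y (wire1 e)) ^ (if s (wire0 IQPOp.CZ e) = true then 1 else 0)) *
          ∏ i, psiT (s i) (y i) ^ tCountW L i * sgnC (y i) ^ czDeg L s i := by
      simp_rw [pow_add, Finset.prod_mul_distrib]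
      have h1 : ∏ i, sgnC (y i) ^ (if wire0 IQPOp.CZ e = i ∧ s (wire1 e) = true then 1 else 0)
          = sgnC (y (wire0 IQPOp.CZ e)) ^ (if s (wire1 e) = true then 1 else 0) := by
        rw [Finset.prod_eq_single (wire0 IQPOp.CZ e)]
        · simp
        · intro i _ hi; rw [if_neg (fun h => hi h.1.symm), pow_zero]
        · intro h; exact absurd (Finset.mem_univ _) h
      have h2 : ∏ i, sgnC (y i) ^ (if wire1 e = i ∧ s (wire0 IQPOp.CZ e) = true then 1 else 0)
          = sgnC (y (wire1 e)) ^ (if s (wire0 IQPOp.CZ e) = true then 1 else 0) := by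
        rw [Finset.prod_eq_single (wire1 e)]
        · simp
        · intro i _ hi; rw [if_neg (fun h => hi h.1.symm), pow_zero]
        · intro h; exact absurd (Finset.mem_univ _) h
      rw [h1, h2]
      ring
    rw [hprod]
    simp only [bxor]
    clear hprod ih
    rcases Bool.eq_false_or_eq_true (s (wire0 IQPOp.CZ e)) with hs0 | hs0 <;>
      rcases Bool.eq_false_or_eq_true (s (wire1 e)) with hs1 | hs1 <;>
        rcases Bool.eq_false_or_eq_true (y (wire0 IQPOp.CZ e)) with hy0 | hy0 <;>
          rcases Bool.eq_false_or_eq_true (y (wire1 e)) with hy1 | hy1 <;>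
            simp [hs0, hs1, hy0, hy1, sgnC] <;> ring

/-- The one-wire sum `Σ_b ψ_{s_i}(b)^t (-1)^{b d}`: `1 + (-1)^d` on an unshifted wire,
`ω^t + ω̄^t (-1)^d` on a shifted one. [folklore] -/
def wireFactor (si : Bool) (t d : ℕ) : ℂ :=
  if si = true then omega8 ^ t + conj omega8 ^ t * (-1) ^ d else 1 + (-1) ^ d

/-- The one-wire sum evaluates to `wireFactor`. [folklore] -/
theorem sum_bool_psiT_pow_mul (si : Bool) (t d : ℕ) :
    ∑ b : Bool, psiT si b ^ t * sgnC b ^ d = wireFactor si t d := by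
  rw [Fintype.sum_bool]
  cases si <;> simp [psiT, sgnC, wireFactor] <;> ring

/-- **The autocorrelation as a product over wires**:
`Σ_y \overline{f(y)} f(y ⊕ s) = (-1)^{#Z on s + #CZ inside s} ∏_i wireFactor(s_i, t_i, λ_i(s))`.
[folklore] -/
theorem sum_corr_eq_prod (L : List (QGate iqpDiag N)) (s : QReg N) :
    ∑ y, corr L s y = (-1) ^ (zOnShift L s + czInShift L s) *
      ∏ i, wireFactor (s i) (tCountW L i) (czDeg L s i) := by
  simp_rw [corr_eq_corrRHS, corrRHS]
  rw [← Finset.mul_sum]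
  congr 1
  rw [← Fintype.prod_sum (fun (i : Fin N) (b : Bool) => psiT (s i) b ^ tCountW L i * sgnC b ^ czDeg L s i)]
  simp_rw [sum_bool_psiT_pow_mul]

/-- The twist by the input only contributes the sign `χ_{supp z}(s)`:
`\overline{g_z(y)} g_z(y ⊕ s) = χ_{supp z}(s) · \overline{f(y)} f(y ⊕ s)`. [cite: BremnerMontanaroShepherd2017, §1 ("⟨x|𝒞|y⟩ = ⟨x+y|𝒞|0⟩")] -/
theorem conj_twistedPhase_mul (D : QCircuit iqpDiag N) (z s y : QReg N) :
    conj (twistedPhase D z y) * twistedPhase D z (bxor y s) =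
      ((walsh (supp z) s : ℝ) : ℂ) * (conj (circPhase D y) * circPhase D (bxor y s)) := by
  rw [twistedPhase, twistedPhase, map_mul, Complex.conj_ofReal, walsh_bxor]
  push_cast
  have hw : ((walsh (supp z) y : ℝ) : ℂ) * ((walsh (supp z) y : ℝ) : ℂ) = 1 := by
    rw [← Complex.ofReal_mul, walsh, ← Finset.prod_mul_distrib]
    simp
  linear_combination (conj (circPhase D y) * circPhase D (bxor y s) * ((walsh (supp z) s : ℝ) : ℂ)) * hw

/-- **Exact Fourier coefficients of the IQP output distribution over `{Z, CZ, T}`**: for the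
circuit with diagonal gate list `D.gates`, input `|z⟩` and `S ⊆ [N]` with indicator `s = 1_S`,
`p̂_z(S) = 4^{-N} χ_{supp z}(s) (-1)^{#Z on s + #CZ inside s} ∏_i wireFactor(s_i, t_i, λ_i(s))` —
an explicit product of `N` numbers from `{0, ±2, ±√2, ±2i, ±i√2}` and a sign, computable in time
`O(N |D|)`. [cite: BremnerMontanaroShepherd2017, §3.1 (p̂(s) for IQP circuits: "we can approximate these coefficients efficiently" — here exactly, for this gate set)] -/
theorem cubeFourierCoeff_iqpProb_eq_prod (D : QCircuit iqpDiag N) (z : QReg N) (S : Finset (Fin N)) :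
    ((cubeFourierCoeff (iqpProb D z) S : ℝ) : ℂ) =
      ((2 : ℂ) ^ N)⁻¹ * ((2 : ℂ) ^ N)⁻¹ * (((walsh (supp z) (indic S) : ℝ) : ℂ) *
        ((-1) ^ (zOnShift D.gates (indic S) + czInShift D.gates (indic S)) *
          ∏ i, wireFactor (indic S i) (tCountW D.gates i) (czDeg D.gates (indic S) i))) := by
  rw [cubeFourierCoeff_iqpProb]
  congr 1
  simp_rw [conj_twistedPhase_mul]
  rw [← Finset.mul_sum]
  congr 1
  exact sum_corr_eq_prod D.gates (indic S)

end Literature.Barriers.QuantumAdvantage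

end
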